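import Mathlib.LinearAlgebra.Dimension.StrongRankCondition
import Mathlib.LinearAlgebra.FreeModule.StrongRankCondition
import Literature.Computability.AlgebraicComplexity.SchoenhageTauBini
import Literature.Computability.AlgebraicComplexity.FlatteningBound
import HarnessLib

/-!
# The slice (flattening) lower bound for the border rank: `bR(t) ≥ #slices`, `bR(⊕ᵢ⟨kᵢ,mᵢ,nᵢ⟩) ≥ ∑ kᵢmᵢ, ∑ mᵢnᵢ, ∑ nᵢkᵢ`

Topic `Literature/Computability/AlgebraicComplexity`. The border-rank (over `K[ε]`, Bläser 2013,
Def. 6.1: `approxRank`, `algBorderRank` of `SchoenhageTau.lean`) version of the flattening bound of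
`FlatteningBound.lean` (`card_le_tensorRank_of_linearIndependent`), which that file lists under
"Not vendored … since the tree has no border rank yet". Everything here is PROVED.

* `card_le_of_isApproxDecomposition` — if the slices `(t a)_{a ∈ ι}` of `t ∈ K^{ι×κ×μ}` are
  linearly independent over the field `K` and `∑_{ρ<r} u_ρ ⊗ v_ρ ⊗ w_ρ = ε^h t + O(ε^{h+1})` over
  `K[ε]`, then `|ι| ≤ r` (Bläser 2013, proof of Lemma 7.1(2): a tensor of "linearly independent
  slices" has border rank at least their number; Bürgisser–Clausen–Shokrollahi 1997, (15.3)/(15.10):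
  `R̲` of a concise tensor is at least each dimension, "since `⟨m,m,m⟩` is concise we have `r ≥ m²`").
  Proof: the `K[ε]`-slices `P_a = ∑_ρ u_ρ(a) · (v_ρ ⊗ w_ρ)` lie in the `K[ε]`-span of the `r`
  matrices `v_ρ ⊗ w_ρ`; they are `K[ε]`-linearly independent because the lowest-order coefficient of
  a `K[ε]`-dependency would be a `K`-dependency of the slices of `t`; a commutative ring satisfies the
  strong rank condition (`linearIndependent_le_span_aux'`).
* `card_le_approxRank_of_linearIndependent`, `card_le_algBorderRank_of_linearIndependent`;
  `approxRank_rotate`, `algBorderRank_rotate` (Bläser 2013, Thm. 6.3(1), equality).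
* `linearIndependent_matMulDirectSum` (and the two rotated families) and the three flattening
  bounds `sum_mul_le_algBorderRank_matMulDirectSum(_left/_right)`:
  `∑ kᵢnᵢ ≤ bR(⊕ᵢ⟨kᵢ,mᵢ,nᵢ⟩)` (`mᵢ ≥ 1`), `∑ kᵢmᵢ ≤ bR` (`nᵢ ≥ 1`), `∑ mᵢnᵢ ≤ bR` (`kᵢ ≥ 1`); in
  particular `card_le_algBorderRank_matMulDirectSum : p ≤ bR(⊕_{i<p}⟨kᵢ,mᵢ,nᵢ⟩)` for positive formats.

Used by `CoppersmithWinograd1982.lean` (no basic algorithm certifies `ω = 2`).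

## References

* M. Bläser, *Fast Matrix Multiplication*, Theory of Computing Graduate Surveys 5 (2013),
  doi:10.4086/toc.gs.2013.005 (held): Def. 6.1, Thm. 6.3(1), Lemma 7.1(2) and its proof (p. 29–30:
  "`bR(⟨k,1,n⟩) = kn` … consist of `kn` linearly independent slices"). [Blaser2013]
* P. Bürgisser, M. Clausen, M. A. Shokrollahi, *Algebraic Complexity Theory*, Springer 1997 (held):
  (15.3), p. 411 ("Since `⟨m,m,m⟩` is concise we have `r ≥ m²`"), Lemma (15.23).
  [BurgisserClausenShokrollahi1997]
-/

noncomputable section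

open scoped BigOperators Polynomial

namespace Literature.Computability.AlgebraicComplexity

universe u v₁ v₂ v₃

/-! ## Rotation does not change `R_h` and `bR` -/

section Rotate

variable {K : Type u} [CommSemiring K] {ι : Type v₁} {κ : Type v₂} {μ : Type v₃}

/-- **Bläser 2013, Thm. 6.3(1)** (cyclic case, equality): `R_h(πt) = R_h(t)` for `π = (1 2 3)`
(finite index types). [cite: Blaser2013, Thm. 6.3(1)] -/
theorem approxRank_rotate [Fintype ι] [Fintype κ] [Fintype μ] [DecidableEq ι] [DecidableEq κ]
    [DecidableEq μ] (h : ℕ) (t : ι → κ → μ → K) : approxRank h (rotate t) = approxRank h t := by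
  refine le_antisymm (approxRank_rotate_le h t) ?_
  have ht : t = rotate (rotate (rotate t)) := rfl
  calc approxRank h t = approxRank h (rotate (rotate (rotate t))) := by rw [← ht]
    _ ≤ approxRank h (rotate (rotate t)) := approxRank_rotate_le h _
    _ ≤ approxRank h (rotate t) := approxRank_rotate_le h _

/-- `bR(πt) = bR(t)` for the cyclic permutation `π = (1 2 3)` of the factors (finite index types).
[cite: Blaser2013, Thm. 6.3(1)] -/
theorem algBorderRank_rotate [Fintype ι] [Fintype κ] [Fintype μ] [DecidableEq ι] [DecidableEq κ]
    [DecidableEq μ] (t : ι → κ → μ → K) : algBorderRank (rotate t) = algBorderRank t := by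
  unfold algBorderRank
  simp_rw [approxRank_rotate]

end Rotate

/-! ## The slice lower bound for approximate decompositions -/

section Concise

variable {K : Type u} [Field K] {ι : Type v₁} {κ : Type v₂} {μ : Type v₃}

/-- **Slice lower bound for the border rank.** If the slices `a ↦ t(a,·,·)` of `t ∈ K^{ι×κ×μ}`
are linearly independent over `K` and `∑_{ρ<r} u_ρ ⊗ v_ρ ⊗ w_ρ = ε^h t + O(ε^{h+1})` over `K[ε]`
(an approximate decomposition of order `h` with `r` triads, Bläser 2013, Def. 6.1), then `|ι| ≤ r`:
the `K[ε]`-slices `∑_ρ u_ρ(a) (v_ρ ⊗ w_ρ)` lie in the span of the `r` matrices `v_ρ ⊗ w_ρ` and are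
`K[ε]`-linearly independent (the lowest-order coefficients of a dependency would give a
`K`-dependency of the slices of `t`). (Bläser 2013, proof of Lemma 7.1(2); BCS 1997, p. 411.)
[cite: Blaser2013, Lemma 7.1(2) (proof)] -/
theorem card_le_of_isApproxDecomposition [Fintype ι] [Fintype κ] [Fintype μ] {t : ι → κ → μ → K}
    (hli : LinearIndependent K (fun a => t a : ι → κ → μ → K)) {h r : ℕ} {u : Fin r → ι → K[X]}
    {v : Fin r → κ → K[X]} {w : Fin r → μ → K[X]} (hd : IsApproxDecomposition h t u v w) :
    Fintype.card ι ≤ r := by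
  classical
  -- the `K[ε]`-slices and the `r` matrices `v_ρ ⊗ w_ρ`
  let P : ι → κ → μ → K[X] := fun a b c => ∑ ρ, u ρ a * v ρ b * w ρ c
  let M : Fin r → κ → μ → K[X] := fun ρ b c => v ρ b * w ρ c
  have hspan : Set.range P ≤ (Submodule.span K[X] (Set.range M) : Set (κ → μ → K[X])) := by
    rintro _ ⟨a, rfl⟩
    have hPa : P a = ∑ ρ, u ρ a • M ρ := by
      funext b c
      simp only [P, M, Finset.sum_apply, Pi.smul_apply, smul_eq_mul]
      exact Finset.sum_congr rfl fun ρ _ => by ring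
    rw [hPa]
    exact Submodule.sum_mem _ fun ρ _ =>
      Submodule.smul_mem _ _ (Submodule.subset_span ⟨ρ, rfl⟩)
  -- `K[ε]`-linear independence of the slices
  have hPli : LinearIndependent K[X] P := by
    rw [Fintype.linearIndependent_iff]
    intro g hg
    by_contra hne
    push Not at hne
    obtain ⟨a₁, ha₁⟩ := hne
    have hex : ∃ j, ∃ a, (g a).coeff j ≠ 0 := by
      by_contra hall
      push Not at hall
      exact ha₁ (Polynomial.ext fun j => by rw [hall j a₁, Polynomial.coeff_zero])
    obtain ⟨a₀, ha₀⟩ : ∃ a, (g a).coeff (Nat.find hex) ≠ 0 := Nat.find_spec hex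
    set m := Nat.find hex with hm
    have hlow : ∀ a, ∀ i < m, (g a).coeff i = 0 := fun a i hi => by
      by_contra hc
      exact Nat.find_min hex hi ⟨a, hc⟩
    -- the coefficient of `ε^(m+h)` of the dependency is a `K`-dependency of the slices
    have key : ∀ b c, ∑ a, (g a).coeff m * t a b c = 0 := by
      intro b c
      have e := congr_fun (congr_fun hg b) c
      rw [Finset.sum_apply, Finset.sum_apply] at e
      simp only [Pi.smul_apply, smul_eq_mul, Pi.zero_apply] at e
      have e2 := congr_arg (fun q : K[X] => q.coeff (m + h)) e
      simp only [Polynomial.finsetSum_coeff, Polynomial.coeff_zero] at e2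
      have e3 : ∀ a, (g a * P a b c).coeff (m + h) = (g a).coeff m * t a b c := by
        intro a
        rw [Polynomial.coeff_mul, Finset.sum_eq_single_of_mem (m, h) (by simp)]
        · have hh := hd a b c h le_rfl
          rw [if_pos rfl] at hh
          rw [hh]
        · rintro ⟨i, j⟩ hij hne'
          rw [Finset.mem_antidiagonal] at hij
          dsimp only at hij ⊢
          rcases lt_trichotomy i m with hi | rfl | hi
          · rw [hlow a i hi, zero_mul]
          · exact (hne' (Prod.ext rfl (by omega))).elim
          · have hj : j < h := by omega
            have hh := hd a b c j hj.le
            rw [if_neg hj.ne] at hh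
            rw [hh, mul_zero]
      calc ∑ a, (g a).coeff m * t a b c = ∑ a, (g a * P a b c).coeff (m + h) :=
          Finset.sum_congr rfl fun a _ => (e3 a).symm
        _ = 0 := e2
    have hK := (Fintype.linearIndependent_iff.1 hli) (fun a => (g a).coeff m) (by
      funext b c
      rw [Finset.sum_apply, Finset.sum_apply]
      simp only [Pi.smul_apply, smul_eq_mul, Pi.zero_apply]
      exact key b c) a₀
    exact ha₀ hK
  have hcard := linearIndependent_le_span_aux' P hPli (Set.range M) hspan
  exact hcard.trans ((Fintype.card_range_le M).trans (Fintype.card_fin r).le)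

/-- `|ι| ≤ R_h(t)` for every `h`, when the slices of `t` along the first factor are linearly
independent (finite formats, so that `R_h(t)` is attained). [cite: Blaser2013, Lemma 7.1(2) (proof)] -/
theorem card_le_approxRank_of_linearIndependent [Fintype ι] [Fintype κ] [Fintype μ]
    (t : ι → κ → μ → K) (hli : LinearIndependent K (fun a => t a : ι → κ → μ → K)) (h : ℕ) :
    Fintype.card ι ≤ approxRank h t := by
  classical
  obtain ⟨u, v, w, hd⟩ := exists_isApproxDecomposition_approxRank h t
  exact card_le_of_isApproxDecomposition hli hd

/-- **Conciseness bound for the border rank**: `|ι| ≤ bR(t)` when the slices of `t` along the first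
factor are linearly independent (Bläser 2013, proof of Lemma 7.1(2); BCS 1997, p. 411: "since
`⟨m,m,m⟩` is concise we have `r ≥ m²`" for `r = R̲`). [cite: Blaser2013, Lemma 7.1(2) (proof)] -/
theorem card_le_algBorderRank_of_linearIndependent [Fintype ι] [Fintype κ] [Fintype μ]
    (t : ι → κ → μ → K) (hli : LinearIndependent K (fun a => t a : ι → κ → μ → K)) :
    Fintype.card ι ≤ algBorderRank t := by
  obtain ⟨h, hh⟩ := exists_algBorderRank_eq_approxRank t
  rw [hh]
  exact card_le_approxRank_of_linearIndependent t hli h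

end Concise

/-! ## The three flattenings of a direct sum of matrix products -/

section DirectSum

variable (K : Type u) [Field K] {p : ℕ}

/-- The `∑ kᵢnᵢ` slices of `⊕ᵢ⟨kᵢ,mᵢ,nᵢ⟩` along the first factor (index `(i; κ, ν)`) are linearly
independent when all `mᵢ ≥ 1`: the slice of `(i; κ, ν)` is the only one with a non-zero entry at
`((i; κ, 0), (i; 0, ν))`. [cite: Blaser2013, Lemma 7.1(2) (proof)] -/
theorem linearIndependent_matMulDirectSum (k m n : Fin p → ℕ) (hm : ∀ i, 1 ≤ m i) :
    LinearIndependent K (fun a => matMulDirectSum K k m n a :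
      (Σ i, Fin (k i) × Fin (n i)) → (Σ i, Fin (k i) × Fin (m i)) → (Σ i, Fin (m i) × Fin (n i)) → K) := by
  rw [Fintype.linearIndependent_iff]
  intro g hg a
  obtain ⟨i, κ₀, ν₀⟩ := a
  have h := congr_fun (congr_fun hg ⟨i, (κ₀, ⟨0, hm i⟩)⟩) ⟨i, (⟨0, hm i⟩, ν₀)⟩
  rw [Finset.sum_apply, Finset.sum_apply,
    Finset.sum_eq_single_of_mem (⟨i, (κ₀, ν₀)⟩ : Σ i, Fin (k i) × Fin (n i)) (Finset.mem_univ _)] at h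
  · simpa [matMulDirectSum] using h
  · rintro ⟨j, κ', ν'⟩ - hne
    simp only [Pi.smul_apply, smul_eq_mul, matMulDirectSum, mul_ite, mul_one, mul_zero,
      ite_eq_right_iff]
    rintro ⟨hji, -, hκ, -, hν⟩
    exfalso
    apply hne
    subst hji
    have hκ' : κ' = κ₀ := Fin.ext hκ
    have hν' : ν' = ν₀ := Fin.ext hν
    subst hκ' hν'
    rfl

/-- The `∑ kᵢmᵢ` slices along the second factor (index `(i; κ, μ)`), i.e. the first-factor slices of
the rotated tensor, are linearly independent when all `nᵢ ≥ 1`. [cite: Blaser2013, Lemma 7.1(2) (proof)] -/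
theorem linearIndependent_rotate_matMulDirectSum (k m n : Fin p → ℕ) (hn : ∀ i, 1 ≤ n i) :
    LinearIndependent K (fun b => rotate (matMulDirectSum K k m n) b :
      (Σ i, Fin (k i) × Fin (m i)) → (Σ i, Fin (m i) × Fin (n i)) → (Σ i, Fin (k i) × Fin (n i)) → K) := by
  rw [Fintype.linearIndependent_iff]
  intro g hg b
  obtain ⟨i, κ₀, μ₀⟩ := b
  have h := congr_fun (congr_fun hg ⟨i, (μ₀, ⟨0, hn i⟩)⟩) ⟨i, (κ₀, ⟨0, hn i⟩)⟩
  rw [Finset.sum_apply, Finset.sum_apply,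
    Finset.sum_eq_single_of_mem (⟨i, (κ₀, μ₀)⟩ : Σ i, Fin (k i) × Fin (m i)) (Finset.mem_univ _)] at h
  · simpa [matMulDirectSum] using h
  · rintro ⟨j, κ', μ'⟩ - hne
    simp only [Pi.smul_apply, smul_eq_mul, rotate_apply, matMulDirectSum, mul_ite, mul_one, mul_zero,
      ite_eq_right_iff]
    rintro ⟨hij, -, hκ, hμ, -⟩
    exfalso
    apply hne
    subst hij
    have hκ' : κ' = κ₀ := Fin.ext hκ.symm
    have hμ' : μ' = μ₀ := Fin.ext hμ
    subst hκ' hμ'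
    rfl

/-- The `∑ mᵢnᵢ` slices along the third factor (index `(i; μ, ν)`), i.e. the first-factor slices of
the twice rotated tensor, are linearly independent when all `kᵢ ≥ 1`. [cite: Blaser2013, Lemma 7.1(2) (proof)] -/
theorem linearIndependent_rotate_rotate_matMulDirectSum (k m n : Fin p → ℕ) (hk : ∀ i, 1 ≤ k i) :
    LinearIndependent K (fun c => rotate (rotate (matMulDirectSum K k m n)) c :
      (Σ i, Fin (m i) × Fin (n i)) → (Σ i, Fin (k i) × Fin (n i)) → (Σ i, Fin (k i) × Fin (m i)) → K) := by
  rw [Fintype.linearIndependent_iff]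
  intro g hg c
  obtain ⟨i, μ₀, ν₀⟩ := c
  have h := congr_fun (congr_fun hg ⟨i, (⟨0, hk i⟩, ν₀)⟩) ⟨i, (⟨0, hk i⟩, μ₀)⟩
  rw [Finset.sum_apply, Finset.sum_apply,
    Finset.sum_eq_single_of_mem (⟨i, (μ₀, ν₀)⟩ : Σ i, Fin (m i) × Fin (n i)) (Finset.mem_univ _)] at h
  · simpa [matMulDirectSum] using h
  · rintro ⟨j, μ', ν'⟩ - hne
    simp only [Pi.smul_apply, smul_eq_mul, rotate_apply, matMulDirectSum, mul_ite, mul_one, mul_zero,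
      ite_eq_right_iff]
    rintro ⟨-, hij, -, hμ, hν⟩
    exfalso
    apply hne
    subst hij
    have hμ' : μ' = μ₀ := Fin.ext hμ.symm
    have hν' : ν' = ν₀ := Fin.ext hν.symm
    subst hμ' hν'
    rfl

/-- **Flattening bound** `∑ᵢ kᵢnᵢ ≤ bR(⊕ᵢ ⟨kᵢ, mᵢ, nᵢ⟩)` (all `mᵢ ≥ 1`): the direct sum is concise
along the first factor. [cite: Blaser2013, Lemma 7.1(2) (proof)] -/
theorem sum_mul_le_algBorderRank_matMulDirectSum (k m n : Fin p → ℕ) (hm : ∀ i, 1 ≤ m i) :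
    ∑ i, k i * n i ≤ algBorderRank (matMulDirectSum K k m n) := by
  have hcard : Fintype.card (Σ i, Fin (k i) × Fin (n i)) = ∑ i, k i * n i := by
    simp [Fintype.card_prod]
  rw [← hcard]
  exact card_le_algBorderRank_of_linearIndependent _ (linearIndependent_matMulDirectSum K k m n hm)

/-- **Flattening bound** `∑ᵢ kᵢmᵢ ≤ bR(⊕ᵢ ⟨kᵢ, mᵢ, nᵢ⟩)` (all `nᵢ ≥ 1`), via `bR(πt) = bR(t)`.
[cite: Blaser2013, Lemma 7.1(2) (proof) and Thm. 6.3(1)] -/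
theorem sum_mul_le_algBorderRank_matMulDirectSum_left (k m n : Fin p → ℕ) (hn : ∀ i, 1 ≤ n i) :
    ∑ i, k i * m i ≤ algBorderRank (matMulDirectSum K k m n) := by
  have hcard : Fintype.card (Σ i, Fin (k i) × Fin (m i)) = ∑ i, k i * m i := by
    simp [Fintype.card_prod]
  rw [← hcard, ← algBorderRank_rotate]
  exact card_le_algBorderRank_of_linearIndependent _
    (linearIndependent_rotate_matMulDirectSum K k m n hn)

/-- **Flattening bound** `∑ᵢ mᵢnᵢ ≤ bR(⊕ᵢ ⟨kᵢ, mᵢ, nᵢ⟩)` (all `kᵢ ≥ 1`), via `bR(π²t) = bR(t)`.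
[cite: Blaser2013, Lemma 7.1(2) (proof) and Thm. 6.3(1)] -/
theorem sum_mul_le_algBorderRank_matMulDirectSum_right (k m n : Fin p → ℕ) (hk : ∀ i, 1 ≤ k i) :
    ∑ i, m i * n i ≤ algBorderRank (matMulDirectSum K k m n) := by
  have hcard : Fintype.card (Σ i, Fin (m i) × Fin (n i)) = ∑ i, m i * n i := by
    simp [Fintype.card_prod]
  rw [← hcard, ← algBorderRank_rotate, ← algBorderRank_rotate]
  exact card_le_algBorderRank_of_linearIndependent _
    (linearIndependent_rotate_rotate_matMulDirectSum K k m n hk)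

/-- For positive formats every block contributes at least `1` to a flattening, so
`p ≤ bR(⊕_{i<p} ⟨kᵢ, mᵢ, nᵢ⟩)`; hence `p < bR` as soon as some `kᵢnᵢ ≥ 2` (used for the side
condition `r > p` of Schönhage's `τ`-theorem). [cite: Blaser2013, Lemma 7.1(2) (proof)] -/
theorem card_le_algBorderRank_matMulDirectSum (k m n : Fin p → ℕ)
    (hpos : ∀ i, 1 ≤ k i ∧ 1 ≤ m i ∧ 1 ≤ n i) : p ≤ algBorderRank (matMulDirectSum K k m n) := by
  have h := sum_mul_le_algBorderRank_matMulDirectSum K k m n fun i => (hpos i).2.1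
  refine le_trans ?_ h
  calc p = ∑ _i : Fin p, 1 := by simp
    _ ≤ ∑ i, k i * n i := Finset.sum_le_sum fun i _ => Nat.mul_pos (hpos i).1 (hpos i).2.2

end DirectSum

end Literature.Computability.AlgebraicComplexity

end
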